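import Summits.HubbardSuperconductivity.HubbardSuperconductivity.Theorems.AnisotropyChordFourTorusCore

/-!
# Route `AnisotropyChord` / crux `FerroSideChord` at `M = 4`: KERNEL-EVALUATED symmetry bookkeeping of the `4 × 4` torus, Ib —
# the weight-8 codes (prover seat `hubbard-h0-rotor-p1` g17)

`check8_lo/hi` — every weight-8 code `k < 2^16` has `cls k < 58`, a witness `wit8 k < 768` with
`actCode (wit8 k) (rep8 (cls k)) = k`; `counts8_eq` — the packed class counts (17-bit fields) are the literal `counts8Lit`.
-/

set_option linter.style.longLine false
set_option linter.dupNamespace false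
set_option autoImplicit false

namespace Summit.HubbardSuperconductivity.HubbardSuperconductivity.Theorems.AnisotropyChord.FourTorus

/-- witness check for one weight-8 code. [folklore] -/
def ok8 (k : ℕ) : Bool :=
  !(pop16 k == 8) || (decide (cls k < 58) && decide (wit8 k < 768) && (actCode (wit8 k) (rep8 (cls k)) == k))
/-- packed class indicator of a weight-8 code (17-bit fields), `0` off the sector. [folklore] -/
def ind8 (k : ℕ) : ℕ := bif pop16 k == 8 then 2 ^ (17 * cls k) else 0
/-- literal: class counts, weight 8 (17-bit fields). [folklore] -/
def counts8Lit : ℕ := 0x4000800180008000800040003000060018000c00020003000080018000c0006000300018000600008000c0000c006000300030001800060003000600006000c000600018001800018000c003000180003000600030000600010006000300006000c000600030000c000c000c0000c0004000200030001800008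
/-- size of the weight-8 class `r`. [folklore] -/
def n8 (r : ℕ) : ℕ := field 17 counts8Lit r

/-- every weight-8 code `< 2^15` carries a checked symmetry witness. [folklore] -/
theorem check8_lo : allHalf 0 ok8 = true := by decide +kernel
/-- every weight-8 code `≥ 2^15` carries a checked symmetry witness. [folklore] -/
theorem check8_hi : allHalf 1 ok8 = true := by decide +kernel
/-- the weight-8 class counts. [folklore] -/
theorem counts8_eq : sum16 ind8 = counts8Lit := by decide +kernel

end Summit.HubbardSuperconductivity.HubbardSuperconductivity.Theorems.AnisotropyChord.FourTorus
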